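import Literature.AlgebraicGeometry.Resolution.WeightedBlowupMonomialStall

/-!
# The termwise stall criterion at an arbitrary point over the origin (pub-rosobs observatory, Proposition S′ generalised)

`WeightedBlowupMonomialStall` proves the monomialwise stall criterion at a COORDINATE point `e_j` of the
exceptional divisor.  This file removes that restriction: at any point `b` over the origin of the centre
(`b none = 0`, `b (some i) = 0` off the centre), if every individual Taylor term of the cobordant transform
`F'(s, u' + b)` — exponent `D ≤ E_β` entrywise and `= E_β` wherever `b = 0` — of degree `< ord₀ F` whose product
of binomial coefficients `∏ C(E_β(o), D(o))` is non-zero in `K` has a `q`-th power exponent, then nothing of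
degree `< ord₀ F` survives the cleaning and the second entry STALLS (`secondEntryStalls_of_termwise`; with
`q ≤ ord₀ F` the point is equimultiple, `isEquimultiplePoint_of_termwise`).  In the observatory's census this
"termwise" class together with two cancellation classes (p-pinch `L·H^p` at zeros of `H`, and translation-
invariant initial forms) accounts for every stall point of the input families (pub-rosobs AGREE-g4 §6).
Scope and published ingredients as in `WeightedBlowupNoIncrease` [AbramovichQuekSchober2025, Def. 4.5;
AbramovichTemkinWlodarczyk2024, §5.1; Hauser2010, §G]. [folklore]
-/

open MvPolynomial Finset

open scoped BigOperators

namespace Literature.AlgebraicGeometry.Resolution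

open Literature.AlgebraicGeometry.Resolution.Hauser2010

noncomputable section

namespace WeightedBlowup

variable {σ : Type*} {K : Type*} [CommRing K] [Fintype σ] [DecidableEq σ]

/-- **Vanishing below the order at an arbitrary point (multi-coordinate monomialwise criterion).** If every
individual Taylor term of `F'(s, u' + b)` — exponent `D ≤ E_β` entrywise, equal to `E_β` wherever `b = 0` — of
degree `< n` whose product of binomial coefficients is non-zero in `K` has a `q`-th power exponent (`hM`), then
every non-`q`-th-power monomial of degree `< n` of `F'(s, u' + b)` has coefficient `0`. (derived here) [folklore] -/
theorem coeff_pointPolynomial_eq_zero_of_termwise (q : ℕ) (w : σ → ℕ) (ℓ : ℕ) (b : Option σ → K)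
    (F : MvPolynomial σ K) (n : ℕ)
    (hM : ∀ β ∈ F.support, ∀ D : Option σ →₀ ℕ, (∀ o, D o ≤ cobordantExponent w ℓ β o) →
        (∀ o, b o = 0 → D o = cobordantExponent w ℓ β o) → D.degree < n →
        (∏ o, (((cobordantExponent w ℓ β o).choose (D o) : ℕ) : K)) ≠ 0 → IsPthPowerExponent q D)
    (D : Option σ →₀ ℕ) (hDn : D.degree < n) (hDq : ¬ IsPthPowerExponent q D) :
    coeff D (pointPolynomial w ℓ b F) = 0 := by
  classical
  unfold pointPolynomial cobordantTransform
  unfold PointBlowup.translate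
  rw [map_sum, coeff_sum]
  change ∑ x ∈ F.support, coeff D
      (PointBlowup.translate b (monomial (cobordantExponent w ℓ x) (coeff x F))) = 0
  refine Finset.sum_eq_zero fun β hβ => ?_
  set E := cobordantExponent w ℓ β with hE
  by_cases h1 : ∃ o, E o < D o
  · obtain ⟨o, ho⟩ := h1
    exact coeff_translate_monomial_eq_zero_of_lt b E D _ ho
  by_cases h2 : ∃ o, b o = 0 ∧ D o < E o
  · obtain ⟨o, hbo, ho⟩ := h2
    exact coeff_translate_monomial_eq_zero_of_apply_eq_zero b E D _ hbo ho
  push Not at h1 h2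
  have hDE : ∀ o, b o = 0 → D o = E o := fun o hbo => le_antisymm (h1 o) (h2 o hbo)
  -- the product of binomial coefficients vanishes in K (else D would be a q-th power exponent)
  have hprod : (∏ o, (((E o).choose (D o) : ℕ) : K)) = 0 := by
    by_contra hne
    exact hDq (hM β hβ D h1 hDE hDn hne)
  rw [coeff_translate_monomial, Finset.prod_mul_distrib, hprod, zero_mul, mul_zero]

/-- **Monomialwise stall criterion at an arbitrary point over the origin.** Same as
`secondEntryStalls_of_monomialwise` with the coordinate point replaced by any point `b` (`b none = 0`,
`b (some i) = 0` off the centre) and hypothesis `hM` of `coeff_pointPolynomial_eq_zero_of_termwise`: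
the second entry STALLS. (derived here) [folklore] -/
theorem secondEntryStalls_of_termwise (q : ℕ) (γ : σ → ℚ) (w : σ → ℕ) (ℓ : ℕ)
    (b : Option σ → K) (F : MvPolynomial σ K) (n : ℕ)
    (hF : deletePthPowers q F = F) (hn : ordZero F = n)
    (hadm : IsAdmissibleFor γ F) (hγn : ∀ i, γ i * n ≤ 1)
    (hw : ∀ i, (w i : ℚ) = ℓ * γ i) (hℓ : 0 < ℓ)
    (hb0 : b none = 0) (hbS : ∀ i, γ i = 0 → b (some i) = 0)
    (hM : ∀ β ∈ F.support, ∀ D : Option σ →₀ ℕ, (∀ o, D o ≤ cobordantExponent w ℓ β o) →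
        (∀ o, b o = 0 → D o = cobordantExponent w ℓ β o) → D.degree < n →
        (∏ o, (((cobordantExponent w ℓ β o).choose (D o) : ℕ) : K)) ≠ 0 → IsPthPowerExponent q D) :
    SecondEntryStalls q w ℓ b F := by
  classical
  unfold SecondEntryStalls
  rw [hF, hn]
  obtain ⟨⟨α, hα, hαn⟩, -⟩ := (ordZero_eq_nat_iff F n).mp hn
  have hαsupp : α ∈ F.support := by simpa [MvPolynomial.mem_support_iff] using hα
  have hnotp : ¬ IsPthPowerExponent q α := by
    intro hp
    apply hα
    rw [← hF, coeff_deletePthPowers, if_pos hp]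
  have hnotpD : ¬ IsPthPowerExponent q (α.mapDomain some) := by
    intro hp
    apply hnotp
    rw [isPthPowerExponent_iff] at hp ⊢
    intro i
    simpa [mapDomain_some_some] using hp (some i)
  have hαne : α ≠ 0 := by
    rintro rfl
    have := hadm 0 hαsupp
    norm_num [monomialValuation] at this
  have hDne : α.mapDomain some ≠ 0 := by
    intro h
    apply hαne
    ext i
    have := congrArg (fun f => f (some i)) h
    simpa [mapDomain_some_some] using this
  have hkey := coeff_pointPolynomial_mapDomain_some γ w ℓ b F α n hadm hγn hw hℓ hb0 hbS hα hαn
  have hcoeff : coeff (α.mapDomain some) (newResidual q w ℓ b F) = coeff α F := by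
    unfold newResidual residual
    rw [coeff_deletePthPowers, if_neg hnotpD, coeff_sub, coeff_C, if_neg (Ne.symm hDne), sub_zero, hkey]
  refine (ordZero_eq_nat_iff _ n).mpr ⟨⟨α.mapDomain some, by rw [hcoeff]; exact hα,
    by rw [degree_mapDomain_some, hαn]⟩, fun D hD => ?_⟩
  unfold newResidual residual
  rw [coeff_deletePthPowers]
  by_cases hDq : IsPthPowerExponent q D
  · rw [if_pos hDq]
  rw [if_neg hDq, coeff_sub, coeff_C]
  have hD0 : D ≠ 0 := by
    rintro rfl
    exact hDq (fun i hi => by simp at hi)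
  rw [if_neg (Ne.symm hD0), sub_zero]
  exact coeff_pointPolynomial_eq_zero_of_termwise q w ℓ b F n hM D (by exact_mod_cast hD) hDq

/-- … and, when `q ≤ n`, the point is equimultiple. (derived here) [folklore] -/
theorem isEquimultiplePoint_of_termwise (q : ℕ) (w : σ → ℕ) (ℓ : ℕ)
    (b : Option σ → K) (F : MvPolynomial σ K) (n : ℕ) (hqn : q ≤ n)
    (hM : ∀ β ∈ F.support, ∀ D : Option σ →₀ ℕ, (∀ o, D o ≤ cobordantExponent w ℓ β o) →
        (∀ o, b o = 0 → D o = cobordantExponent w ℓ β o) → D.degree < n →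
        (∏ o, (((cobordantExponent w ℓ β o).choose (D o) : ℕ) : K)) ≠ 0 → IsPthPowerExponent q D) :
    IsEquimultiplePoint q w ℓ b F := by
  classical
  unfold IsEquimultiplePoint
  unfold ordZero
  refine MvPowerSeries.le_order fun D hD => ?_
  rw [MvPolynomial.coeff_coe]
  have hDq' : D.degree < q := by exact_mod_cast hD
  unfold residual
  rw [coeff_sub, coeff_C]
  by_cases hD0 : D = 0
  · subst hD0
    rw [if_pos rfl, ← MvPolynomial.constantCoeff_eq, sub_self]
  rw [if_neg (Ne.symm hD0), sub_zero]
  by_cases hDq : IsPthPowerExponent q D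
  · exact absurd (le_degree_of_isPthPowerExponent q D hDq hD0) (not_le.mpr hDq')
  · exact coeff_pointPolynomial_eq_zero_of_termwise q w ℓ b F n hM D (lt_of_lt_of_le hDq' hqn) hDq

end WeightedBlowup

end

end Literature.AlgebraicGeometry.Resolution
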